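import Summits.RiemannHypothesis.RiemannHypothesis.Theorems.SuzukiOutputsWeilForm
import Summits.RiemannHypothesis.RiemannHypothesis.Theorems.SuzukiThetaFlowOutputsCoercive
import Summits.RiemannHypothesis.RiemannHypothesis.Theorems.LogSobolevHolder

/-!
# The θ-flow window outputs lie in the Connes–Consani form domain; `OutputsCoercive` by the form-domain
# road (column DBR; RH-FREE)

RH-FREE throughout (line 1 label); nothing here bears on the truth of RH.  Binder **K2a** of the cell's
round-2 rung route `ThetaFlowDecay` (rh-dbr theory g10, HOME/rh-dbr-theory/round2; director-rh g7 re-cut (i)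
2026-08-26T21:07Z «K2a: g_θ ∈ `ConnesConsani2023.formDomain`; K2b: `Re Q(g_θ) = E_N(g_θ)` beyond
`IsWeilTest`»), and with it the form-domain road to crux K2 `OutputsCoercive` — whose tree proof
`SuzukiThetaFlow.outputsCoercive` (`Theorems/SuzukiThetaFlowOutputsCoercive`, rh-dbr-eng-2 g5) goes by
mollification and the continuity of `ε`; the road here is the one the route was planned on.
For `θ > 1`, a window `(−t,t)`, `t > 0`, and `f ∈ L²(−t,t)`, the output `g_θ = 𝟙_{(−t,t)}·𝖪_θ[t]f`
(`winOut θ t f`, [Su20] (1.4)) satisfies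

* `winOut_mem_formDomain` (K2a): `g_θ ∈ ConnesConsani2023.formDomain t` — square-integrable, supported in
  `[−t,t]`, finite log-Sobolev energy `∫|ĝ_θ(½+is)|²(1+log(1+s²)) ds < ∞` (Connes–Consani 2023, Lemma 2.2
  (2.16): the form domain of `QW_λ`, `λ = e^t`); also for `f ∈ L¹(−t,t)` (`winOut_mem_formDomain_of_integrableOn`);
* `weilGroundEnergy_mul_winNormSq_le_weilFinitePrimeQuadratic`: `ε(t)·‖𝖪_θ[t]f‖²_{L²(−t,t)} ≤ E_{⌊e^{2t}⌋}(g_θ)`,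
  `ε(t) = weilGroundEnergy t`, `E_N = weilFinitePrimeQuadratic N` — the tree's
  `YoshidaCompletedForm.weilGroundEnergy_le_weilFinitePrimeQuadratic` (`ε ≤ E_N` on the unit sphere of the
  form domain) made homogeneous on the WHOLE form domain (`weilGroundEnergy_mul_le_weilFinitePrimeQuadratic`);
* hence K2 `ε(t)·‖𝖪_θ[t]f‖² ≤ Re Q(g_θ)` by ONE rewrite with K2b =
  `re_weilQuadratic_winOut_eq_weilFinitePrimeQuadratic` (`Theorems/SuzukiOutputsWeilForm`, [rh-dbr-eng] g7) — not
  restated here (the statement is the landed `SuzukiThetaFlow.weilGroundEnergy_mul_winNormSq_le` /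
  `outputsCoercive`; gate dedup), this file being the form-domain road to it.

WHAT THIS IS NOT: not the decay law (tree: `SuzukiThetaFlow.thetaFlowDecay`), no sign of `ε(t)` or of `Q`
asserted, no statement about zeros; nothing here is progress toward RH.

## Method — a Besov embedding, not «BV with one jump»

* §1 GENERAL RH-FREE LEMMA `logSobolevEnergy_lt_top_of_holder`: if `g ∈ L¹ ∩ L²(ℝ)` has a HÖLDER
  `L²`-MODULUS OF CONTINUITY `∫‖g(x−h) − g(x)‖² dx ≤ C h^δ` (`0 < h ≤ 1`, some `δ > 0`), then
  `logSobolevEnergy g < ∞` — every such `g` supported in `[−a,a]` is in `formDomain a` (step functions,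
  piecewise-Hölder windows, …; the tree's `ZetaCyclesFiniteSections.logSobolevEnergy_chi_lt_top` is the
  special case `χ_n`).  Proof: shift law `(g(·−h) − g)^(½+is) = (e^{ish} − 1) ĝ(½+is)` (`weilMellin_shift_sub`),
  Plancherel for `L¹ ∩ L²` (tree `ConnesConsani2023.integral_norm_sq_weilMellin_half_line_of_memLp`):
  `∫(2 − 2cos(sh))|ĝ|² = 2π∫‖g(·−h) − g‖²` (`integral_cos_weight_norm_sq_weilMellin`), and a DYADIC pointwise
  bound (`ofReal_mul_logWeight_le`): on `|s| < 2`, `1 + log(1+s²) ≤ 5`; on `2^{j+1} ≤ |s| < 2^{j+2}`,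
  `1 + log(1+s²) ≤ 4(j+2)` and `2 − 2cos(s·h_j) ≥ 1` for `h_j = (π/3)2^{−(j+1)}` (`|s|h_j ∈ [π/3, 2π/3]`), whence
  `E(g) ≤ 5·2π‖g‖₂² + Σ_j 4(j+2)·2π·C h_j^δ < ∞` (geometric series; `logSobolevEnergy_le_dyadic`).
* §2 THE WINDOW OUTPUT: `G = 𝖪_θ[t]f` is bounded and Hölder on `ℝ` (tree `abs_winOp_sub_le`,
  `continuous_winOp` of `Theorems/SuzukiFlowPairingWeilSide`, from the Hölder modulus of `K_θ`,
  `Theorems/SuzukiKernelHolder` — ANY exponent `ε > 0` suffices, so the cusps `(x − log n)_+^{θ−1}` of `K_θ`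
  for `θ < 2` are no obstacle), hence `∫‖g_θ(·−h) − g_θ‖² ≤ C h^ε` (interior Hölder part + two boundary
  layers of width `h`; `integral_norm_sq_winOut_shift_sub_le`), and `winOut_mem_formDomain`.
* §3 homogeneity (null case `‖ξ‖₂ = 0` by `ξ = 0` a.e.) and the corollaries above.

References: A. Connes, C. Consani, *Spectral triples and ζ-cycles*, Enseign. Math. 69 (2023) §2.1
(Prop. 2.1, Lemma 2.2 (2.16)); [Su20] M. Suzuki, ASPM 84 (2020) (1.4); E. Bombieri, Rend. Lincei (9)
11 (2000) §4 (the ground energy `ε`); H. Yoshida, ASPM 21 (1992) §2 (`E_N`).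
-/


noncomputable section

-- D-0017: `Summit.<S>.<S>.…` is the designed namespace of a single-problem summit.
set_option linter.dupNamespace false

open Complex MeasureTheory Set Filter Topology
open scoped Real ENNReal

namespace Summit.RiemannHypothesis.RiemannHypothesis.Theorems.SuzukiThetaFlow

open Literature.NumberTheory.LFunctions
open Literature.NumberTheory.ConnesConsani2023
open Summit.RiemannHypothesis.RiemannHypothesis.Theorems.LogSobolevHolder

/-! ## §2 The window output `g_θ = 𝟙_{(−t,t)}·𝖪_θ[t]f` has a Hölder `L²`-modulus -/

section Window

variable {θ t : ℝ} {f : ℝ → ℝ}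

/-- RH-FREE.  `g_θ` is the indicator of the window applied to the complexified output. -/
theorem winOut_eq_indicator (θ t : ℝ) (f : ℝ → ℝ) :
    winOut θ t f = (Ioo (-t) t).indicator (fun x ↦ ((winOp (limKernel θ) t f x : ℝ) : ℂ)) := by
  funext x
  unfold winOut
  by_cases hx : x ∈ Ioo (-t) t
  · rw [indicator_of_mem hx, indicator_of_mem hx]
  · rw [indicator_of_notMem hx, indicator_of_notMem hx, Complex.ofReal_zero]

/-- RH-FREE.  **HÖLDER `L²`-MODULUS OF THE WINDOW OUTPUT**: for `θ > 1`, `t > 0`, `f ∈ L¹(−t,t)` there are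
`C ≥ 0` and `0 < ε ≤ 1` with `∫‖g_θ(x−h) − g_θ(x)‖² dx ≤ C h^ε` for `0 < h ≤ 1` (interior: the Hölder
modulus of `𝖪_θ[t]f`, `abs_winOp_sub_le`; boundary: two layers of width `h` where `g_θ` is bounded). -/
theorem integral_norm_sq_winOut_shift_sub_le (ht : 0 < t) (hθ : 1 < θ) (hf : IntegrableOn f (Ioo (-t) t)) :
    ∃ C ε : ℝ, 0 ≤ C ∧ 0 < ε ∧ ∀ h : ℝ, 0 < h → h ≤ 1 →
      ∫ x, ‖winOut θ t f (x - h) - winOut θ t f x‖ ^ 2 ≤ C * h ^ ε := by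
  set G : ℝ → ℝ := winOp (limKernel θ) t f with hG
  obtain ⟨C, ε, hC, hε0, hε1, hH⟩ := abs_winOp_sub_le hθ hf
  -- a bound for `G` on `[−t−1, t+1]`
  obtain ⟨M, hM⟩ := (isCompact_Icc (a := -t - 1) (b := t + 1)).exists_bound_of_continuousOn
    (continuous_winOp hθ hf).continuousOn
  have hM0 : 0 ≤ M := le_trans (norm_nonneg _) (hM 0 ⟨by linarith, by linarith⟩)
  set L : ℝ := ∫ y in Ioo (-t) t, |f y| with hL
  have hL0 : 0 ≤ L := integral_nonneg fun y ↦ abs_nonneg _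
  set A : ℝ := C * Real.exp (t + |t|) * L with hA
  have hA0 : 0 ≤ A := by positivity
  refine ⟨A ^ 2 * (2 * t + 2) + M ^ 2 * 2, ε, by positivity, hε0, fun h hh0 hh1 ↦ ?_⟩
  have hhε : h ≤ h ^ ε := by
    conv_lhs => rw [← Real.rpow_one h]
    exact Real.rpow_le_rpow_of_exponent_ge hh0 hh1 hε1
  have hhε0 : 0 ≤ h ^ ε := Real.rpow_nonneg hh0.le ε
  -- the dominating step function
  set P : ℝ → ℝ := fun x ↦ (Icc (-t - 1) (t + 1)).indicator (fun _ ↦ (A * h ^ ε) ^ 2) x +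
    ((Icc (-t) (-t + h)).indicator (fun _ ↦ M ^ 2) x + (Icc t (t + h)).indicator (fun _ ↦ M ^ 2) x) with hP
  have hW : ∀ x, x ∈ Ioo (-t) t → x ∈ Icc (-t - 1) (t + 1) := fun x hx ↦
    ⟨by linarith [hx.1], by linarith [hx.2]⟩
  have hGM : ∀ x, x ∈ Ioo (-t) t → ‖((G x : ℝ) : ℂ)‖ ^ 2 ≤ M ^ 2 := fun x hx ↦ by
    have h1 : ‖G x‖ ≤ M := hM x (hW x hx)
    rw [Complex.norm_real]
    exact pow_le_pow_left₀ (norm_nonneg _) h1 2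
  have hpt : ∀ x : ℝ, ‖winOut θ t f (x - h) - winOut θ t f x‖ ^ 2 ≤ P x := by
    intro x
    rw [winOut_eq_indicator]
    have hP1 : 0 ≤ (Icc (-t - 1) (t + 1)).indicator (fun _ ↦ (A * h ^ ε) ^ 2) x :=
      Set.indicator_nonneg (fun _ _ ↦ by positivity) x
    have hP2 : 0 ≤ (Icc (-t) (-t + h)).indicator (fun _ ↦ M ^ 2) x :=
      Set.indicator_nonneg (fun _ _ ↦ by positivity) x
    have hP3 : 0 ≤ (Icc t (t + h)).indicator (fun _ ↦ M ^ 2) x :=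
      Set.indicator_nonneg (fun _ _ ↦ by positivity) x
    by_cases hx : x ∈ Ioo (-t) t
    · by_cases hxh : x - h ∈ Ioo (-t) t
      · -- interior: Hölder
        rw [indicator_of_mem hxh, indicator_of_mem hx, ← Complex.ofReal_sub, Complex.norm_real,
          Real.norm_eq_abs]
        have h1 := hH (x - h) h (by rw [abs_of_pos hh0]; exact hh1)
        rw [sub_add_cancel, abs_of_pos hh0] at h1
        have h2 : Real.exp (x - h + |t|) ≤ Real.exp (t + |t|) := Real.exp_le_exp.2 (by linarith [hxh.2])
        have h3 : |G x - G (x - h)| ≤ A * h ^ ε := by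
          calc |G x - G (x - h)| ≤ C * Real.exp (x - h + |t|) * L * h ^ ε := h1
            _ ≤ C * Real.exp (t + |t|) * L * h ^ ε := by gcongr
        have h4 : |G (x - h) - G x| ^ 2 ≤ (A * h ^ ε) ^ 2 := by
          rw [abs_sub_comm] 
          exact pow_le_pow_left₀ (abs_nonneg _) h3 2
        calc |G (x - h) - G x| ^ 2 ≤ (Icc (-t - 1) (t + 1)).indicator (fun _ ↦ (A * h ^ ε) ^ 2) x := by
              rw [indicator_of_mem (hW x hx)]; exact h4
          _ ≤ P x := by simp only [hP]; linarith
      · -- left boundary layer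
        rw [indicator_of_notMem hxh, indicator_of_mem hx, zero_sub, norm_neg]
        have hxl : x ∈ Icc (-t) (-t + h) := by
          refine ⟨hx.1.le, ?_⟩
          by_contra hcon
          exact hxh ⟨by linarith, by linarith [hx.2]⟩
        calc ‖((G x : ℝ) : ℂ)‖ ^ 2 ≤ (Icc (-t) (-t + h)).indicator (fun _ ↦ M ^ 2) x := by
              rw [indicator_of_mem hxl]; exact hGM x hx
          _ ≤ P x := by simp only [hP]; linarith
    · by_cases hxh : x - h ∈ Ioo (-t) t
      · -- right boundary layer
        rw [indicator_of_mem hxh, indicator_of_notMem hx, sub_zero]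
        have hxr : x ∈ Icc t (t + h) := by
          refine ⟨?_, by linarith [hxh.2]⟩
          by_contra hcon
          exact hx ⟨by linarith [hxh.1], by linarith⟩
        calc ‖((G (x - h) : ℝ) : ℂ)‖ ^ 2 ≤ (Icc t (t + h)).indicator (fun _ ↦ M ^ 2) x := by
              rw [indicator_of_mem hxr]; exact hGM (x - h) hxh
          _ ≤ P x := by simp only [hP]; linarith
      · rw [indicator_of_notMem hxh, indicator_of_notMem hx, sub_zero, norm_zero,
          zero_pow two_ne_zero]
        simp only [hP]; linarith
  -- integrate the step function
  have hI1 : Integrable ((Icc (-t - 1) (t + 1)).indicator fun _ : ℝ ↦ (A * h ^ ε) ^ 2) :=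
    (integrableOn_const (by rw [Real.volume_Icc]; exact ENNReal.ofReal_ne_top)).integrable_indicator
      measurableSet_Icc
  have hI2 : Integrable ((Icc (-t) (-t + h)).indicator fun _ : ℝ ↦ M ^ 2) :=
    (integrableOn_const (by rw [Real.volume_Icc]; exact ENNReal.ofReal_ne_top)).integrable_indicator
      measurableSet_Icc
  have hI3 : Integrable ((Icc t (t + h)).indicator fun _ : ℝ ↦ M ^ 2) :=
    (integrableOn_const (by rw [Real.volume_Icc]; exact ENNReal.ofReal_ne_top)).integrable_indicator
      measurableSet_Icc
  have hI23 : Integrable fun x : ℝ ↦ (Icc (-t) (-t + h)).indicator (fun _ : ℝ ↦ M ^ 2) x +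
      (Icc t (t + h)).indicator (fun _ : ℝ ↦ M ^ 2) x := hI2.add hI3
  have hPint : Integrable P := hI1.add hI23
  have hPval : ∫ x, P x = (A * h ^ ε) ^ 2 * (2 * t + 2) + (M ^ 2 * h + M ^ 2 * h) := by
    simp only [hP]
    rw [integral_add hI1 hI23, integral_add hI2 hI3, integral_indicator_const _ measurableSet_Icc,
      integral_indicator_const _ measurableSet_Icc, integral_indicator_const _ measurableSet_Icc,
      Real.volume_real_Icc, Real.volume_real_Icc, Real.volume_real_Icc, smul_eq_mul, smul_eq_mul, smul_eq_mul,
      max_eq_left (by linarith), max_eq_left (by linarith), max_eq_left (by linarith)]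
    ring
  calc ∫ x, ‖winOut θ t f (x - h) - winOut θ t f x‖ ^ 2 ≤ ∫ x, P x :=
        integral_mono_of_nonneg (Eventually.of_forall fun x ↦ by positivity) hPint
          (Eventually.of_forall hpt)
    _ = (A * h ^ ε) ^ 2 * (2 * t + 2) + (M ^ 2 * h + M ^ 2 * h) := hPval
    _ ≤ (A ^ 2 * (2 * t + 2) + M ^ 2 * 2) * h ^ ε := by
        have h1 : (h ^ ε) ^ 2 ≤ h ^ ε := by
          have : h ^ ε ≤ 1 := Real.rpow_le_one hh0.le hh1 hε0.le
          nlinarith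
        nlinarith [mul_nonneg (sq_nonneg A) (by linarith : (0:ℝ) ≤ 2 * t + 2), sq_nonneg M]

/-- RH-FREE · **K2a** — **THE WINDOW OUTPUTS LIE IN THE FORM DOMAIN**: for `t > 0`, `θ > 1` and `f ∈ L²(−t,t)`,
`g_θ = 𝟙_{(−t,t)}·𝖪_θ[t]f ∈ ConnesConsani2023.formDomain t` (square-integrable, supported in `[−t,t]`,
`∫|ĝ_θ(½+is)|²(1 + log(1+s²)) ds < ∞`).  Binder K2a of route `ThetaFlowDecay` (theory g10 round 2). -/
theorem winOut_mem_formDomain (ht : 0 < t) (hθ : 1 < θ) (hf : MemLp f 2 (winMeasure t)) :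
    winOut θ t f ∈ formDomain t := by
  have hfi : IntegrableOn f (Ioo (-t) t) := integrableOn_of_memLp_winMeasure hf
  obtain ⟨C, ε, -, hε, hmod⟩ := integral_norm_sq_winOut_shift_sub_le ht hθ hfi
  exact ⟨memLp_two_winOut hθ hfi, support_winOut_subset θ t f,
    logSobolevEnergy_lt_top_of_holder (integrable_winOut hθ hfi) (memLp_two_winOut hθ hfi) hε hmod⟩

/-- RH-FREE.  The same for `f ∈ L¹(−t,t)` (the form-domain membership needs only integrability of `f`). -/
theorem winOut_mem_formDomain_of_integrableOn (ht : 0 < t) (hθ : 1 < θ) (hf : IntegrableOn f (Ioo (-t) t)) :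
    winOut θ t f ∈ formDomain t := by
  obtain ⟨C, ε, -, hε, hmod⟩ := integral_norm_sq_winOut_shift_sub_le ht hθ hf
  exact ⟨memLp_two_winOut hθ hf, support_winOut_subset θ t f,
    logSobolevEnergy_lt_top_of_holder (integrable_winOut hθ hf) (memLp_two_winOut hθ hf) hε hmod⟩

end Window

/-! ## §3 Coercivity of the finite-prime form on the window outputs (K2 on the `E_N` side; RH-FREE) -/

section Coercive

/-- RH-FREE.  **`ε(a)·‖ξ‖₂² ≤ E_{N(a)}(ξ)` on the WHOLE form domain** (the tree's unit-sphere statement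
`YoshidaCompletedForm.weilGroundEnergy_le_weilFinitePrimeQuadratic` made homogeneous with
`weilFinitePrimeQuadratic_smul`; the null case `‖ξ‖₂ = 0` by `ξ = 0` a.e.).  No sign of `ε(a)` is asserted. -/
theorem weilGroundEnergy_mul_le_weilFinitePrimeQuadratic {a : ℝ} (ha : 0 < a) {ξ : ℝ → ℂ}
    (hξ : ξ ∈ formDomain a) :
    weilGroundEnergy a * ∫ x, ‖ξ x‖ ^ 2 ≤ weilFinitePrimeQuadratic (primeCutoff a) ξ := by
  set n : ℝ := ∫ x, ‖ξ x‖ ^ 2 with hn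
  have hint2 : Integrable fun x ↦ ‖ξ x‖ ^ 2 := integrable_norm_sq_of_memLp hξ.1
  have hn0 : 0 ≤ n := integral_nonneg fun x ↦ by positivity
  rcases hn0.eq_or_lt with hzero | hpos
  · -- `‖ξ‖₂ = 0`: `ξ = 0` a.e., all terms vanish
    have hae : (fun x ↦ ‖ξ x‖ ^ 2) =ᵐ[volume] 0 :=
      (integral_eq_zero_iff_of_nonneg (fun x ↦ by positivity) hint2).1 hzero.symm
    have hξ0 : ξ =ᵐ[volume] 0 := by
      filter_upwards [hae] with x hx
      have : ‖ξ x‖ ^ 2 = 0 := hx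
      exact norm_eq_zero.1 (pow_eq_zero_iff two_ne_zero |>.1 this)
    have hM : ∀ w : ℂ, weilMellin ξ w = 0 := fun w ↦ by
      unfold weilMellin
      rw [← integral_zero (α := ℝ) (G := ℂ)]
      exact integral_congr_ae (by filter_upwards [hξ0] with x hx; simp [hx])
    have hN2 : weilNorm2Sq ξ = 0 := by
      unfold weilNorm2Sq
      exact hzero.symm ▸ hn ▸ rfl
    have hE : weilFinitePrimeQuadratic (primeCutoff a) ξ = 0 := by
      unfold weilFinitePrimeQuadratic
      simp [hM, hN2]
    rw [← hzero, hE, mul_zero]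
  · -- normalise to the unit sphere
    set c : ℂ := (((Real.sqrt n)⁻¹ : ℝ) : ℂ) with hc
    have hcn : ‖c‖ ^ 2 = n⁻¹ := by
      rw [hc, Complex.norm_real, Real.norm_eq_abs, abs_of_nonneg (inv_nonneg.2 (Real.sqrt_nonneg _)),
        inv_pow, Real.sq_sqrt hpos.le]
    have hcξ : (c • ξ) ∈ formDomain a := by
      have h := const_mul_mem_formDomain c hξ
      exact h
    have hunit : ∫ x, ‖(c • ξ) x‖ ^ 2 = 1 := by
      have e : (fun x ↦ ‖(c • ξ) x‖ ^ 2) = fun x ↦ ‖c‖ ^ 2 * ‖ξ x‖ ^ 2 := by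
        funext x
        simp [mul_pow]
      rw [e, integral_const_mul, hcn, ← hn, inv_mul_cancel₀ hpos.ne']
    have h := YoshidaCompletedForm.weilGroundEnergy_le_weilFinitePrimeQuadratic ha hcξ hunit
    rw [weilFinitePrimeQuadratic_smul, hcn] at h
    -- `ε ≤ n⁻¹ E` ⇒ `ε n ≤ E`
    have := mul_le_mul_of_nonneg_right h hpos.le
    rwa [mul_comm (n⁻¹) _, mul_assoc, inv_mul_cancel₀ hpos.ne', mul_one] at this

variable {θ t : ℝ} {f : ℝ → ℝ}

/-- RH-FREE · **COERCIVITY OF `E_N` ON THE WINDOW OUTPUTS** (crux K2 of route `ThetaFlowDecay` on the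
finite-prime side): for `t > 0`, `θ > 1`, `f ∈ L²(−t,t)`,
`ε(t)·‖𝖪_θ[t]f‖²_{L²(−t,t)} ≤ E_{⌊e^{2t}⌋}(g_θ)`, `g_θ = 𝟙_{(−t,t)}𝖪_θ[t]f`.  What remains of K2 is the
identification `Re weilQuadratic(g_θ) = E_{⌊e^{2t}⌋}(g_θ)` (binder K2b: the tree's
`weilQuadratic_eq_weilFinitePrimeQuadratic` beyond `IsWeilTest`).  No sign of `ε(t)` is asserted. -/
theorem weilGroundEnergy_mul_winNormSq_le_weilFinitePrimeQuadratic (ht : 0 < t) (hθ : 1 < θ)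
    (hf : MemLp f 2 (winMeasure t)) :
    weilGroundEnergy t * winNormSq (limKernel θ) t f ≤
      weilFinitePrimeQuadratic (primeCutoff t) (winOut θ t f) := by
  rw [← integral_norm_sq_winOut θ t f]
  exact weilGroundEnergy_mul_le_weilFinitePrimeQuadratic ht (winOut_mem_formDomain ht hθ hf)

end Coercive

end Summit.RiemannHypothesis.RiemannHypothesis.Theorems.SuzukiThetaFlow

end
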